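import Mathlib.CategoryTheory.Galois.Basic
import Mathlib.CategoryTheory.Comma.Over.Pullback
import Mathlib.CategoryTheory.Adjunction.Limits
import Mathlib.CategoryTheory.Limits.Constructions.EpiMono
import Literature.AnabelianGeometry.Anabelioids.Basic
import Literature.AnabelianGeometry.Anabelioids.FiberFunctorUnique
import HarnessLib

/-!
# Anabelioids: the basepoint induced by a finite étale morphism is a basepoint

Mochizuki, *The geometry of anabelioids*, Publ. RIMS **40** (2004), §1.1 Def. 1.1.2 (ii) p. 10 ("a
morphism `φ : X → Y` … induces a basepoint `φ ∘ β` of `Y` from a basepoint `β` of `X`": the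
pull-back functor of a morphism of connected anabelioids is exact, so `φ^* ⋙ β` is again a fibre
functor) and §1.2 Def. 1.2.2 (i) p. 17 (finite étale: `φ^* ≅ i_S^* ∘ α^*`)
[cite: MochizukiGeoAn2004, Def. 1.1.2(ii) p.10].

PROOF-ONLY glue for the local dictionary (`FiniteEtaleLocalDictionary*.lean`; abc-iut L3 row
`L3:FiniteEtaleLocalDictionary`, L6-t17): to instantiate the `SemiGraphs` statements (which quantify
over basepoints `G` with `[FiberFunctor G]`) at the basepoint `Q ⋙ F` induced from a basepoint `F`
of `D` along a finite étale pull-back `Q ≅ (S × −) ⋙ α`, and to obtain the comparison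
`β : Q ⋙ F ≅ G` with any other basepoint (`nonempty_iso_of_fiberFunctor`), one needs
`FiberFunctor (Q ⋙ F)`.  Recorded here as `Nonempty (FiberFunctor _)` theorems (no definitions):

* `nonempty_fiberFunctor_of_iso` — the fibre-functor property transports along a natural
  isomorphism;
* `nonempty_fiberFunctor_star_comp` — `(S × −) ⋙ α ⋙ F` is a fibre functor of `C`, GIVEN the
  colimit-exactness of `Over.star S = (S × −) : C → C_{/S}` as instance hypotheses (finite
  coproducts, epimorphisms, quotients by finite groups, reflection of isomorphisms — the items
  [GeoAn] packs into "`i_S^*` is exact"; the limit half is free, `Over.star S` being a right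
  adjoint); they are discharged where `Over.star` exactness is proved (abc-iut-L3-t5/t6,
  `OverPullbackExact` / the G25 constructor files);
* `nonempty_fiberFunctor_of_iso_star_comp`, `nonempty_iso_fiberFunctor_of_iso_star_comp` — hence
  `FiberFunctor (Q ⋙ F)` and `Q ⋙ F ≅ G` for every basepoint `G` of `C`.
-/

namespace Literature.AnabelianGeometry.Anabelioids

open CategoryTheory CategoryTheory.Limits CategoryTheory.Functor CategoryTheory.PreGaloisCategory

universe w u₁ u₂ u₃

section OfIso

variable {C : Type u₁} [Category.{u₂} C] [PreGaloisCategory C]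

/-- The fibre-functor property transports along a natural isomorphism `F ≅ G`.
[cite: MochizukiGeoAn2004, Def. 1.1.2(ii) p.10] -/
theorem nonempty_fiberFunctor_of_iso {F G : C ⥤ FintypeCat.{w}} (i : F ≅ G) [FiberFunctor G] :
    Nonempty (FiberFunctor F) := by
  haveI : PreservesLimitsOfShape (Discrete PEmpty.{1}) F := preservesLimitsOfShape_of_natIso i.symm
  haveI : PreservesLimitsOfShape WalkingCospan F := preservesLimitsOfShape_of_natIso i.symm
  haveI : PreservesFiniteCoproducts F := ⟨fun _ => preservesColimitsOfShape_of_natIso i.symm⟩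
  haveI : F.PreservesEpimorphisms := Functor.preservesEpimorphisms.of_iso i.symm
  haveI : F.ReflectsIsomorphisms := ⟨fun f hf => by
    haveI : IsIso (G.map f) := (NatIso.isIso_map_iff i f).mp hf
    exact isIso_of_reflects_iso f G⟩
  exact ⟨{ preservesQuotientsByFiniteGroups := fun _ _ _ => preservesColimitsOfShape_of_natIso i.symm }⟩

end OfIso

section StarComp

variable {C : Type u₁} [Category.{u₂} C] [GaloisCategory C]
  {D : Type u₃} [Category.{u₂} D] [GaloisCategory D]

/-- **`(S × −) ⋙ α ⋙ F` is a basepoint of `C`** for an equivalence `α : C_{/S} ⥲ D` and a basepoint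
`F` of `D`, given the exactness of `i_S^* = (S × −) : C → C_{/S}` beyond limits (finite coproducts,
epimorphisms, quotients by finite groups, reflection of isomorphisms — instance hypotheses,
discharged by the `Over.star` exactness files). [cite: MochizukiGeoAn2004, Def. 1.1.2(ii) p.10] -/
theorem nonempty_fiberFunctor_star_comp (S : C) (α : Over S ⥤ D) [α.IsEquivalence]
    (F : D ⥤ FintypeCat.{u₂}) [FiberFunctor F]
    [(Over.star S).ReflectsIsomorphisms] [PreservesFiniteCoproducts (Over.star S)]
    [(Over.star S).PreservesEpimorphisms]
    [hq : ∀ (G : Type u₂) [Group G] [Finite G], PreservesColimitsOfShape (SingleObj G) (Over.star S)] :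
    Nonempty (FiberFunctor (Over.star S ⋙ α ⋙ F)) :=
  ⟨{ preservesQuotientsByFiniteGroups := fun _ _ _ => inferInstance }⟩

/-- Hence `Q ⋙ F` is a basepoint of `C` for any `Q ≅ (S × −) ⋙ α` (a finite étale pull-back functor
in the sense of `IsFiniteEtale`), under the same hypotheses. [cite: MochizukiGeoAn2004, Def. 1.2.2(i) p.17] -/
theorem nonempty_fiberFunctor_of_iso_star_comp (S : C) (α : Over S ⥤ D) [α.IsEquivalence]
    {Q : C ⥤ D} (e : Q ≅ Over.star S ⋙ α) (F : D ⥤ FintypeCat.{u₂}) [FiberFunctor F]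
    [(Over.star S).ReflectsIsomorphisms] [PreservesFiniteCoproducts (Over.star S)]
    [(Over.star S).PreservesEpimorphisms]
    [hq : ∀ (G : Type u₂) [Group G] [Finite G], PreservesColimitsOfShape (SingleObj G) (Over.star S)] :
    Nonempty (FiberFunctor (Q ⋙ F)) := by
  obtain ⟨h⟩ := nonempty_fiberFunctor_star_comp S α F (hq := hq)
  haveI : FiberFunctor ((Over.star S ⋙ α) ⋙ F) := h
  exact nonempty_fiberFunctor_of_iso (isoWhiskerRight e F)

/-- **The comparison `β : Q ⋙ F ≅ G`** with an arbitrary basepoint `G` of `C` exists ([SGA1] V 5.7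
via `nonempty_iso_of_fiberFunctor`), under the same hypotheses — the `β` consumed by
`range_pi1Map_eq_stabilizer`. [cite: MochizukiGeoAn2004, Def. 1.1.2(ii) p.10] -/
theorem nonempty_iso_fiberFunctor_of_iso_star_comp (S : C) (α : Over S ⥤ D) [α.IsEquivalence]
    {Q : C ⥤ D} (e : Q ≅ Over.star S ⋙ α) (F : D ⥤ FintypeCat.{u₂}) [FiberFunctor F]
    (G : C ⥤ FintypeCat.{u₂}) [FiberFunctor G]
    [(Over.star S).ReflectsIsomorphisms] [PreservesFiniteCoproducts (Over.star S)]
    [(Over.star S).PreservesEpimorphisms]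
    [hq : ∀ (G : Type u₂) [Group G] [Finite G], PreservesColimitsOfShape (SingleObj G) (Over.star S)] :
    Nonempty (Q ⋙ F ≅ G) := by
  obtain ⟨h⟩ := nonempty_fiberFunctor_of_iso_star_comp S α e F (hq := hq)
  haveI := h
  exact nonempty_iso_of_fiberFunctor (Q ⋙ F) G

end StarComp

end Literature.AnabelianGeometry.Anabelioids
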